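import Summits.ValiantsHypothesis.ValiantsHypothesis.Theorems.KPlusLogSqLawTropicalCensusRows

/-!
# Route «KPlusLogSqLaw» — the explicit `K = 4` tropical family GRADED ROTATION-WALK (GRW-lite): definitions

HONEST FRAMING.  Definitions-only file (D-0009) of a helper chain `--supports` the crux
`Summit.ValiantsHypothesis.ValiantsHypothesis.Theses.KPlusLogSqLaw.TropicalB` (ledger item `stmt-ValiantsHypothesis-19771`, route
`KPlusLogSqLaw`; cell `pub-symmetroid`, lineage val-sym-trop-p3: family found by g13 (memo GRW-g13.md, kernel cells `(6..11, 4)`),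
closed-form valuations and certificate by g14, 2026-08-28).  It names ONE explicit tropical design per format `(m, 4)`, `m = n + 1`, in the
tree's dominance vocabulary (`tropWeight`, `termSign`, `IsDominant` of `MatrixDescartesFalseOfTropicalMonster.lean`), its intended chain of
`2m² + 2` Leibniz terms and the bookkeeping functions of the proof; nothing is proved here (companion files prove that every chain term is
the unique optimum at its slope and that consecutive terms alternate in sign, whence `TropicalCensus.TropRootLawAt m 4 B → 2m² + 1 ≤ B`
for every `m ≥ 1` — twice the tree's all-`m` floor `m² + 2m` of SHIFT-SQUARE / DIAMOND).  Concrete witnesses, not notions: no statement of the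
route depends on them.  Nothing here asserts `TropicalB`, `WeakLifting`, `KPlusLogSqLaw`, `MatrixDescartes` or anything about `VP ≠ VNP`;
the family is quadratic, so the cell's `K = 4` fork (quadratic versus cubic growth of `T(m,4)`) is untouched.

THE DESIGN (order type graded-lex).  Classes `0 < 1 < 2 < 3` with exponents `d = (0, A, A + B, A + B + 1)`, `B = m + 1`, `A = m(m + 3)`
(`bB`, `AA`, `dd`).  PHASE `w ∈ [0, m]`: the base permutation is the rotation `b ↦ b + (m − w)` (`rot`); the columns `b ≥ w` WRAP (row `b − w`,
class `0`), the columns `b < w` form the BLOCK (rows `[m − w, m)`, block cell `(r, c) ↔ (m − w + r, c)`, classes `1, 2, 3`).  STATES `(w, u, t)`: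
`(u, 0)`, `u ≤ w` = block diagonal with class `2` on the columns `c < u` and class `1` on `c ≥ u`; EXCURSION `(u, t)`, `1 ≤ t ≤ u ≤ w − 1`
(`t ≤ 1` unless `w = m`) = the same with the block rows `u − t, …, u` cycled: 3-CELLS `(c + 1, c)` of class `3` for `u − t ≤ c ≤ u − 1` and the
CONNECTOR `(u − t, u)` of class `1`; TOP `(w, w, t)`, `t ≤ w` = block diagonal with class `3` on `c < t`, class `2` else.  Chain order (`stepS`):
`(0,0), (1,0), (1,1), (2,0), (2,1), …, (w−1,1), (w,0), (w,w,1), …, (w,w,w)` inside phase `w < m` (`3w` states, `1` for `w = 0`), and in phase `m`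
the full walk `(u,0), (u,1), …, (u,u)` for every `u < m` followed by the top states (`C(m+2,2)` states): `2m² + 2` terms.
SLOPES (`theta`): `θ(w,u,t) = L·w + M_w·u + 4t` (`2t` on top states), `L = 8m(m+3)`, `M_w = 2(m+3)` for `w < m`, `M_m = m² + 4m + 8`.
VALUATIONS (`vv`, closed forms; LEVEL `E = m − (a − b)` of a lower cell, `E = m` on the diagonal): class `0` on `a ≤ b` costs `4m(m+3)²(b−a)²`;
the block classes cost `v1 E b` (+ `B·tau2 E b` from class `2` on, + `tau3 E b` for class `3`), where `v1` is the cumulative «switch-time» sum of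
the column (`jfun` = the inter-level jump pinned by the excursion tie equations, `defic`/`jct` = the exact compensation of the phase-boundary
`m`-cycle carried by the junction column, `T2 k = C(k,2)`, `T6 k = Σ_{i<k} i²`); the connector `(u − t, u)` of class `1` costs `conn t u`
(pinned by the deep-walk ties).  SIGNS (`ee`): `(−1)^{ab}`-pattern on the block with class `3 = −` class `2`, column `0` flipping class `2`,
diagonal classes `(Z₀·[b=0] ∨ +, (−1)^b, −1, +1)`, wrap class `0` positive except the top row `(0, b) ↦ zsign b` (the phase-boundary parity
`zpar`), connectors `(−1)^u` (`(−1)^{u+1}` in row `0`).  POTENTIALS of the dual certificate are in the companion files.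
-/

set_option linter.dupNamespace false
set_option autoImplicit false

namespace Summit.ValiantsHypothesis.ValiantsHypothesis.Theorems.LacunarySymmetroidMatrixDescartes.TropicalCensus

open Summit.ValiantsHypothesis.ValiantsHypothesis.Theorems.MatrixDescartes.Negative
open scoped BigOperators
open Finset

namespace GradedWalk

variable (n : ℕ)

/-! ### parameters (`m = n + 1`) -/

/-- `m = n + 1` as an integer. -/
def mZ : ℤ := (n : ℤ) + 1
/-- `B = m + 1`: the middle exponent step. -/
def bB : ℤ := (n : ℤ) + 2
/-- `g = m + 3 = B + 2`: the gauge constant (`A = g·m`). -/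
def gG : ℤ := (n : ℤ) + 4
/-- `A = m(m + 3)`: the exponent of class `1`. -/
def AA : ℕ := (n + 1) * (n + 4)
/-- `L = 8m(m + 3)`: the phase period of the slope schedule. -/
def LL : ℤ := 8 * ((n : ℤ) + 1) * ((n : ℤ) + 4)
/-- `M = 2(m + 3)`: the `u`-spacing of the slope schedule in the phases `w < m`. -/
def MM : ℤ := 2 * ((n : ℤ) + 4)
/-- `H = L / 2`. -/
def HH : ℤ := 4 * ((n : ℤ) + 1) * ((n : ℤ) + 4)
/-- `M_m = m² + 4m + 8`: the `u`-spacing in the last phase. -/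
def M2 : ℤ := ((n : ℤ) + 1) ^ 2 + 4 * ((n : ℤ) + 1) + 8

/-- exponents `d = (0, A, A + B, A + B + 1)`. -/
def dd : Fin 4 → ℕ := ![0, AA n, AA n + (n + 2), AA n + (n + 2) + 1]

/-- `T2 k = C(k, 2) = Σ_{i<k} i`. -/
def T2 : ℕ → ℤ
  | 0 => 0
  | k + 1 => T2 k + k

/-- `T6 k = Σ_{i<k} i² = (k−1)k(2k−1)/6`. -/
def T6 : ℕ → ℤ
  | 0 => 0
  | k + 1 => T6 k + (k : ℤ) ^ 2

/-! ### valuations -/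

/-- the inter-level jump `J(E, b) = V₁(E+1, b) − V₃(E, b)` of column `b` at level `E < m` (pinned by the excursion tie equations):
`L(E − b) + H − b·M·(B + E − b) − b²`. -/
def jfun (E b : ℤ) : ℤ := LL n * (E - b) + HH n - b * MM n * (bB n + E - b) - b * b

/-- the `m`-cycle deficit at the phase boundary `w → w + 1`: `Σ_{1 ≤ b < w} (Tt(w) − J(w, b))`. -/
def defic (w : ℕ) : ℤ := (LL n + MM n * (bB n + w)) * T2 w - (MM n - 1) * T6 w

/-- the nominal boundary time `Tt(w) = L·w + H`. -/
def tt (w : ℤ) : ℤ := LL n * w + HH n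

/-- the junction jump of column `w` (wrap top level `w` → first block level `w + 1`): `g·Tt(w) + defic(w)`. -/
def jct (w : ℕ) : ℤ := gG n * tt n w + defic n w

/-- class-`2` switch time `τ₂(E, b)` (times `B` it is `V₂ − V₁`). -/
def tau2 (E b : ℕ) : ℤ :=
  if E = n + 1 then LL n * ((n : ℤ) + 1) + M2 n * b + 4 * b + 3 else LL n * E + MM n * b + 5

/-- class-`3` switch time `τ₃(E, b) = V₃ − V₂`. -/
def tau3 (E b : ℕ) : ℤ :=
  if E = n + 1 then LL n * ((n : ℤ) + 1) + M2 n * ((n : ℤ) + 1) + 2 * b + 1 else LL n * E + MM n * E + 2 * b + 1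

/-- class-`1` valuation of column `b` at level `E` (`b + 1 ≤ E ≤ m`), closed form of the cumulative switch-time sum. -/
def v1 (E b : ℕ) : ℤ :=
  4 * mZ n * gG n ^ 2 * (b : ℤ) ^ 2 + gG n * (LL n * b + HH n) + defic n b
    + (gG n * LL n + MM n * (1 - (b : ℤ))) * (T2 E - T2 (b + 1))
    + ((E : ℤ) - 1 - b) * (5 * bB n + 1 + HH n + (2 - LL n) * b + (MM n - 1) * (b : ℤ) ^ 2)

/-- valuation of class `l ≥ 1` of column `b` at level `E`. -/
def vblk (E b : ℕ) (l : Fin 4) : ℤ :=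
  v1 n E b + (if 2 ≤ (l : ℕ) then bB n * tau2 n E b else 0) + (if (l : ℕ) = 3 then tau3 n E b else 0)

/-- connector price, constant coefficient (in `t`). -/
def calpha (u : ℤ) : ℤ :=
  mZ n ^ 3 * u + 8 * mZ n ^ 4 + 2 * mZ n * u ^ 2 - 6 * mZ n ^ 2 * u + 48 * mZ n ^ 3 - 16 * mZ n * u
    + 68 * mZ n ^ 2 + 5 * u ^ 2 - 9 * mZ n + 20 * u + 1
/-- connector price, linear coefficient. -/
def cbeta (u : ℤ) : ℤ := -mZ n ^ 3 - 4 * mZ n * u + 7 * mZ n ^ 2 + 20 * mZ n - 10 * u - 8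
/-- connector price, quadratic coefficient. -/
def cgamma : ℤ := 2 * mZ n + 5

/-- valuation of the CONNECTOR `(u − t, u)` of class `1`, `1 ≤ t ≤ u`:
`V₁(m, u) + Σ_{s=1}^{t} (α + β s + γ s²)` (deep-walk tie equations). -/
def conn (t u : ℕ) : ℤ := v1 n (n + 1) u + calpha n u * t + cbeta n u * T2 (t + 1) + cgamma n * T6 (t + 1)

/-- the valuations of the design. -/
def vv : Fin (n + 1) → Fin (n + 1) → Fin 4 → ℤ := fun a b l =>
  if (b : ℕ) < (a : ℕ) then vblk n (n + 1 + b - a) b l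
  else if (a : ℕ) = (b : ℕ) then (if (l : ℕ) = 0 then 0 else vblk n (n + 1) b l)
  else (if (l : ℕ) = 0 then 4 * mZ n * gG n ^ 2 * ((b : ℤ) - a) ^ 2 else conn n (b - a) b)

/-! ### signs -/

/-- parity summand of the phase-boundary sign recursion. -/
def zstep (v : ℕ) : ℕ := (n + 1) + v + (if 1 ≤ v then 1 else 0) + n * v + v * (v - 1) / 2

/-- partial sums of `zstep`. -/
def zsum : ℕ → ℕ
  | 0 => 0
  | v + 1 => zsum v + zstep n v

/-- the sign carried by the top-row wrap cell `(0, b)` of class `0`: `(−1)^{Σ_{b ≤ v < m} zstep v}`. -/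
def zsign (b : ℕ) : ℤ := (-1) ^ (zsum n (n + 1) + zsum n b)

/-- the presence/sign pattern of the design (`0` = absent). -/
def ee : Fin (n + 1) → Fin (n + 1) → Fin 4 → ℤ := fun a b l =>
  if (b : ℕ) < (a : ℕ) then
    (if (l : ℕ) = 0 then 0
     else if (l : ℕ) = 1 then (-1) ^ ((a : ℕ) * b)
     else if (l : ℕ) = 2 then (-1) ^ ((a : ℕ) * b) * (if (b : ℕ) = 0 then -1 else 1)
     else -((-1) ^ ((a : ℕ) * b) * (if (b : ℕ) = 0 then -1 else 1)))
  else if (a : ℕ) = (b : ℕ) then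
    (if (l : ℕ) = 0 then (if (b : ℕ) = 0 then zsign n 0 else 1)
     else if (l : ℕ) = 1 then (-1) ^ (b : ℕ)
     else if (l : ℕ) = 2 then -1 else 1)
  else
    (if (l : ℕ) = 0 then (if (a : ℕ) = 0 then zsign n b else 1)
     else if (l : ℕ) = 1 then (if (a : ℕ) = 0 then (-1) ^ ((b : ℕ) + 1) else (-1) ^ (b : ℕ))
     else 0)

/-! ### states, slopes and terms -/

/-- the `u`-spacing of phase `w`. -/
def Mw (w : ℕ) : ℤ := if w = n + 1 then M2 n else MM n

/-- the slope of state `(w, u, t)`. -/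
def theta (w u t : ℕ) : ℤ := LL n * w + Mw n w * u + (if u < w then 4 * (t : ℤ) else 2 * (t : ℤ))

/-- the base rotation of phase `w`: `b ↦ b + (m − w)`. -/
def rot (w : ℕ) : Equiv.Perm (Fin (n + 1)) := (finRotate (n + 1)) ^ (n + 1 - w)

/-- the deep-walk cycle on the rows `u − t, …, u` (as a permutation of row values): `cyc u t = swap(u−t, u−t+1) ∘ cyc u (t−1)`. -/
def cyc (u : ℕ) : ℕ → Equiv.Perm (Fin (n + 1))
  | 0 => 1
  | t + 1 => Equiv.swap (⟨(u - (t + 1)) % (n + 1), Nat.mod_lt _ (Nat.succ_pos n)⟩ : Fin (n + 1))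
      (⟨(u - t) % (n + 1), Nat.mod_lt _ (Nat.succ_pos n)⟩ : Fin (n + 1)) * cyc u t

/-- the permutation of state `(w, u, t)`: the rotation of phase `w`, with the block rows `m − w + u − t, …, m − w + u` cycled (top states
`u = w` are plain rotations). -/
def perm (w u t : ℕ) : Equiv.Perm (Fin (n + 1)) := if u = w then rot n w else cyc n (n + 1 - w + u) t * rot n w

/-- the class map of state `(w, u, t)`: wrap columns `b ≥ w` class `0`; top states (`u = w`): class `3` on `b < t`, else `2`;
other states: class `2` on `b < u − t`, class `3` on `u − t ≤ b < u`, class `1` on `b ≥ u`. -/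
def lam (w u t : ℕ) : Fin (n + 1) → Fin 4 := fun b =>
  if w ≤ (b : ℕ) then 0
  else if u = w then (if (b : ℕ) < t then 3 else 2)
  else if (b : ℕ) + t < u then 2 else if (b : ℕ) < u then 3 else 1

/-- the Leibniz term of state `(w, u, t)`. -/
def cterm (w u t : ℕ) : Equiv.Perm (Fin (n + 1)) × (Fin (n + 1) → Fin 4) := (perm n w u t, lam n w u t)

/-- excursion depth allowed at `(w, u)`: `1` in the phases `w < m` (none at `u = 0`), `u` in phase `m`. -/
def cap (w u : ℕ) : ℕ := if w < n + 1 then min u 1 else u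

/-- successor of a state in chain order. -/
def stepS (x : ℕ × ℕ × ℕ) : ℕ × ℕ × ℕ :=
  if x.2.1 < x.1 then (if x.2.2 < cap n x.1 x.2.1 then (x.1, x.2.1, x.2.2 + 1) else (x.1, x.2.1 + 1, 0))
  else (if x.2.2 < x.1 then (x.1, x.1, x.2.2 + 1) else (x.1 + 1, 0, 0))

/-- the `k`-th state of the chain. -/
def gridS (k : ℕ) : ℕ × ℕ × ℕ := (stepS n)^[k] (0, 0, 0)

/-- the number of breakpoints: `2m² + 1`. -/
def N : ℕ := 2 * (n + 1) ^ 2 + 1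

end GradedWalk

end Summit.ValiantsHypothesis.ValiantsHypothesis.Theorems.LacunarySymmetroidMatrixDescartes.TropicalCensus
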